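import Summits.Ventures.Crystal3D.Theorems.StickyWulffConstantNoReconstructionGainMovedPlug
import HarnessLib

/-!
# Placement-free form of the atom: rigidly moved substrates

HONEST FRAMING. Part of the venture `Summits/Ventures/Crystal3D` (cell `crystal3d-full`), helper
`--supports` the crux `NoReconstructionGain` (stmt-Ventures-19144, route
`route-Ventures-StickyWulffConstant`), line `adhesion`; answers cf-p1 g16's standing ask for
PLACEMENT-FREE forms (the T line's `stub_barlowAdhesion` quantifies over rigidly moved substrates
`stacking L s σ = L '' barlowStacking σ + s`).  g6's `…MovedPlug` moved the two gauge rungs; here the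
move is done once for the atom WITH AN ARBITRARY SIDE CONDITION `Φ` inherited under the pull-back, so
that every fcc-plate rung of the line (fixed normal `ν`, constants `R, C`, radius `ρ`) yields the same
rung for the plate cut from the moved lattice `A Λ₀ + t` by the moved window (normal `A ν`, same
`R, ρ`), with the same constant:

* `adhesion_rigidMotion_of_invariant` — if the atom holds at `ν` for all `(X, P)` with `Φ X P`, `P`
  the `ν`-slab sample of `Λ₀`, then for every linear isometry `A` and translation `t` it holds for
  all `(X, P)` with `Φ X P`, `P = {q : A⁻¹(q − t) ∈ that sample}`.

Pull back by the isometry `q ↦ A⁻¹(q − t)` (`isometry_pullback`, `card_cross_image_of_isometry`,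
`contactDeficiency_image_of_isometry` of `…MovedPlug` / `…AffineSampleDeficit`).

WHAT THIS IS NOT: substrates other than rigid images of the fcc lattice `Λ₀` (no other Hägg words);
no new case of the atom; rung F-C1 not moved.
-/

noncomputable section

namespace Summit.Ventures.Crystal3D.Theorems

open Summit.Ventures.Crystal3D Finset
open Literature.MathematicalPhysics.StatisticalMechanics (fccStacking orderedContacts contactDeficiency)
open scoped InnerProductSpace

/-- **The atom for a rigidly moved substrate, with an inherited side condition.** -/
theorem adhesion_rigidMotion_of_invariant :
    ∀ (Φ : Finset (EuclideanSpace ℝ (Fin 3)) → Finset (EuclideanSpace ℝ (Fin 3)) → Prop)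
    (A : EuclideanSpace ℝ (Fin 3) ≃ₗᵢ[ℝ] EuclideanSpace ℝ (Fin 3)) (t : EuclideanSpace ℝ (Fin 3)),
    (∀ X P : Finset (EuclideanSpace ℝ (Fin 3)), Φ X P →
      Φ (X.image fun q => A.symm (q - t)) (P.image fun q => A.symm (q - t))) →
    ∀ (ν : EuclideanSpace ℝ (Fin 3)) (R C ρ : ℝ),
    (∀ X P : Finset (EuclideanSpace ℝ (Fin 3)), (∀ p ∈ X, ∀ q ∈ X, p ≠ q → 1 ≤ dist p q) →
      P ⊆ X →
      (∀ p, p ∈ P ↔ (p ∈ Literature.MathematicalPhysics.StatisticalMechanics.fccStacking 1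
        (Real.sqrt (2 / 3)) ∧ -(2 * R) ≤ ⟪p, ν⟫_ℝ ∧ ⟪p, ν⟫_ℝ ≤ -R ∧ ‖p‖ ^ 2 - ⟪p, ν⟫_ℝ ^ 2 ≤ ρ ^ 2)) →
      Φ X P →
      ((((P ×ˢ (X \ P)).filter fun pq => dist pq.1 pq.2 = 1).card : ℕ) : ℝ) ≤
        Literature.MathematicalPhysics.StatisticalMechanics.contactDeficiency (X \ P) + C * ρ) →
    ∀ X P : Finset (EuclideanSpace ℝ (Fin 3)), (∀ p ∈ X, ∀ q ∈ X, p ≠ q → 1 ≤ dist p q) →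
      P ⊆ X →
      (∀ q, q ∈ P ↔ (A.symm (q - t) ∈ Literature.MathematicalPhysics.StatisticalMechanics.fccStacking 1
        (Real.sqrt (2 / 3)) ∧ -(2 * R) ≤ ⟪A.symm (q - t), ν⟫_ℝ ∧ ⟪A.symm (q - t), ν⟫_ℝ ≤ -R ∧
        ‖A.symm (q - t)‖ ^ 2 - ⟪A.symm (q - t), ν⟫_ℝ ^ 2 ≤ ρ ^ 2)) →
      Φ X P →
      ((((P ×ˢ (X \ P)).filter fun pq => dist pq.1 pq.2 = 1).card : ℕ) : ℝ) ≤
        Literature.MathematicalPhysics.StatisticalMechanics.contactDeficiency (X \ P) + C * ρ := by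
  classical
  intro Φ A t hΦ ν R C ρ h X P hX hPX hP hΦXP
  set m : EuclideanSpace ℝ (Fin 3) → EuclideanSpace ℝ (Fin 3) := fun q => A.symm (q - t) with hm
  have hmi : Isometry m := isometry_pullback A t
  have hinj : Function.Injective m := hmi.injective
  set X' := X.image m with hX'
  set P' := P.image m with hP'def
  have hsd : X' \ P' = (X \ P).image m := by
    rw [hX', hP'def, image_sdiff_of_injOn hinj.injOn hPX]
  have hXp : ∀ p ∈ X', ∀ q ∈ X', p ≠ q → 1 ≤ dist p q := by
    intro p hp q hq hpq
    obtain ⟨p₀, hp₀, rfl⟩ := mem_image.1 hp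
    obtain ⟨q₀, hq₀, rfl⟩ := mem_image.1 hq
    rw [hmi.dist_eq]
    exact hX p₀ hp₀ q₀ hq₀ fun e => hpq (by rw [e])
  have hPXp : P' ⊆ X' := image_subset_image hPX
  have hback : ∀ q, A (m q) + t = q := fun q => by simp [hm]
  have hPp : ∀ p, p ∈ P' ↔ (p ∈ fccStacking 1 (Real.sqrt (2 / 3)) ∧ -(2 * R) ≤ ⟪p, ν⟫_ℝ ∧
      ⟪p, ν⟫_ℝ ≤ -R ∧ ‖p‖ ^ 2 - ⟪p, ν⟫_ℝ ^ 2 ≤ ρ ^ 2) := by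
    intro p
    rw [hP'def, mem_image]
    constructor
    · rintro ⟨q, hq, rfl⟩
      exact (hP q).1 hq
    · intro hp
      refine ⟨A p + t, (hP (A p + t)).2 ?_, ?_⟩
      · have e : A.symm (A p + t - t) = p := by simp
        rw [e]; exact hp
      · simp [hm]
  have hmain := h X' P' hXp hPXp hPp (hΦ X P hΦXP)
  rw [hsd, hP'def, card_cross_image_of_isometry hmi, contactDeficiency_image_of_isometry hmi] at hmain
  exact hmain

end Summit.Ventures.Crystal3D.Theorems
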